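import Mathlib
import Summits.MatrixMultiplication.MatrixMultiplication.Theorems.LevelGradedCohnUmansGradedDesignFamilyFrameSpan
import Summits.MatrixMultiplication.MatrixMultiplication.Theorems.LevelTwoBeatsCubes.Negative.GradedNeumannCount

/-!
# The standing ceiling for the quadratic-extension cell: `|φ(SL₂ k)|·(|Z| + |Y| − 1) ≤ |K|³ + |K|²`
# (crux `LevelGradedCohnUmans.GradedDesignFamily`, stmt-MatrixMultiplication-7610; negative side,
# line `quadratic-extension-level-one-cell`, stub `subfieldCell_ceiling`)

The line's open design stub S3 (`stub_subfieldCell`) asks for finite sets `Y, Z ⊆ GL₂(K)`,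
level-one ("frame function") separated against the image of an injective hom `φ : SL₂(k) →* GL₂(K)`:
for every target `z₀ ∈ Z` a table `cf : K² → K² → ℂ` with
`Σ_u cf u ((φ a · y · y'⁻¹ · z) u) = [a = 1 ∧ y = y' ∧ z = z₀]` on `SL₂(k) × Y × Y × Z`,
with `|Y|, |Z| ≥ c |K|^{3/2}` and `|K| = |k|²`.  This file records the CEILING every such attempt must
respect:

* `subfieldCell_ceiling` — `|φ(SL₂ k)|·|Z| + |φ(SL₂ k)|·(|Y| − 1) ≤ |K|³ + |K|²`.

PROOF (composition of landed results).  Let `F₁(K) := span{g ↦ Σ_u c u (g·u)} ≤ ℂ^{GL₂(K)}` be the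
level-one test space.  It is bi-invariant (`SubfieldCell.frameSpan_biInv`), in particular
right-translation invariant; the one-subgroup identity test (`SubfieldCell.frameSeparated_image`)
upgrades the hypothesis to frame separators for every target `(x₀, z₀) ∈ φ(SL₂ k) × Z`, and every
frame function lies in `F₁(K)` (`Submodule.subset_span`).  The graded Neumann count
(`LevelTwoBeatsCubes.Negative.packing_X`, targets `X⁻¹Z` plus one translated slab) then gives
`|X||Z| + |X|(|Y| − 1) ≤ dim F₁(K)` for `X := φ(SL₂ k)`, and `dim F₁(K) ≤ |K|³ + |K|²`
(`SubfieldCell.finrank_frameSpan_le`, from the landed frame-structure stub S2).  Since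
`|φ(SL₂ k)| = |SL₂(k)| = |k|³ − |k| ∼ |K|^{3/2}`, this caps the constant of S3 at `c ≤ 1/2 + o(1)`.

Sorry-free; axioms `propext`, `Classical.choice`, `Quot.sound`.
-/

set_option linter.dupNamespace false

noncomputable section

open scoped BigOperators
open Module

namespace Summit.MatrixMultiplication.MatrixMultiplication.Theorems.GradedDesignFamily.Negative

/-- **The standing ceiling for the quadratic-extension cell.**  If `Y, Z ⊆ GL₂(K)` are nonempty and
level-one separated against the image of an injective hom `φ : SL₂(k) →* GL₂(K)` (S3's separation
clause, verbatim), then `|φ(SL₂ k)|·|Z| + |φ(SL₂ k)|·(|Y| − 1) ≤ |K|³ + |K|²` — the graded Neumann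
count in the level-one test space `F₁(K)`, whose dimension is at most `|K|³ + |K|²`.
[cite: Neumann2011, Observation 3.1] -/
theorem subfieldCell_ceiling {k K : Type} [Field k] [Fintype k] [DecidableEq k] [Field K]
    [Fintype K] [DecidableEq K]
    (φ : Matrix.SpecialLinearGroup (Fin 2) k →* Matrix.GeneralLinearGroup (Fin 2) K)
    (hφ : Function.Injective φ) (Y Z : Finset (Matrix.GeneralLinearGroup (Fin 2) K))
    (hY : Y.Nonempty) (hZ : Z.Nonempty)
    (hsep : ∀ z₀ ∈ Z, ∃ cf : (Fin 2 → K) → (Fin 2 → K) → ℂ,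
      ∀ a : Matrix.SpecialLinearGroup (Fin 2) k, ∀ y ∈ Y, ∀ y' ∈ Y, ∀ z ∈ Z,
        (∑ u : Fin 2 → K, cf u (((φ a * y * y'⁻¹ * z : Matrix.GeneralLinearGroup (Fin 2) K) :
            Matrix (Fin 2) (Fin 2) K).mulVec u)) =
          if a = 1 ∧ y = y' ∧ z = z₀ then 1 else 0) :
    (Finset.univ.image φ).card * Z.card + (Finset.univ.image φ).card * (Y.card - 1) ≤
      Fintype.card K ^ 3 + Fintype.card K ^ 2 := by
  -- right-translation invariance of the level-one test space `F₁(K)` (from bi-invariance)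
  have hr : ∀ f ∈ Submodule.span ℂ {f : Matrix.GeneralLinearGroup (Fin 2) K → ℂ |
        ∃ c : (Fin 2 → K) → (Fin 2 → K) → ℂ, f = fun g : Matrix.GeneralLinearGroup (Fin 2) K =>
          ∑ u : Fin 2 → K, c u ((g : Matrix (Fin 2) (Fin 2) K).mulVec u)},
      ∀ h : Matrix.GeneralLinearGroup (Fin 2) K, (fun g => f (g * h)) ∈
        Submodule.span ℂ {f : Matrix.GeneralLinearGroup (Fin 2) K → ℂ |
          ∃ c : (Fin 2 → K) → (Fin 2 → K) → ℂ, f = fun g : Matrix.GeneralLinearGroup (Fin 2) K =>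
            ∑ u : Fin 2 → K, c u ((g : Matrix (Fin 2) (Fin 2) K).mulVec u)} :=
    fun f hf h => by simpa only [one_mul] using SubfieldCell.frameSpan_biInv K f hf 1 h
  -- the one-subgroup identity test: separators for every target `(x₀, z₀) ∈ φ(SL₂ k) × Z`,
  -- rewritten in the implication form the graded Neumann count consumes
  have hsepX := SubfieldCell.frameSeparated_image φ hφ Y Z hsep
  have hsep' : ∀ x₀ ∈ Finset.univ.image φ, ∀ z₀ ∈ Z,
      ∃ f ∈ Submodule.span ℂ {f : Matrix.GeneralLinearGroup (Fin 2) K → ℂ |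
        ∃ c : (Fin 2 → K) → (Fin 2 → K) → ℂ, f = fun g : Matrix.GeneralLinearGroup (Fin 2) K =>
          ∑ u : Fin 2 → K, c u ((g : Matrix (Fin 2) (Fin 2) K).mulVec u)},
      ∀ x ∈ Finset.univ.image φ, ∀ y ∈ Y, ∀ y' ∈ Y, ∀ z ∈ Z,
        (x = x₀ ∧ y = y' ∧ z = z₀ → f (x⁻¹ * y * y'⁻¹ * z) = 1) ∧
        (¬ (x = x₀ ∧ y = y' ∧ z = z₀) → f (x⁻¹ * y * y'⁻¹ * z) = 0) := by
    intro x₀ hx₀ z₀ hz₀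
    obtain ⟨cf, hcf⟩ := hsepX x₀ hx₀ z₀ hz₀
    refine ⟨fun g => ∑ u : Fin 2 → K, cf u ((g : Matrix (Fin 2) (Fin 2) K).mulVec u),
      Submodule.subset_span ⟨cf, rfl⟩, fun x hx y hy y' hy' z hz => ⟨fun h => ?_, fun h => ?_⟩⟩
    · exact (hcf x hx y hy y' hy' z hz).trans (if_pos h)
    · exact (hcf x hx y hy y' hy' z hz).trans (if_neg h)
  obtain ⟨y₁, hy₁⟩ := hY
  obtain ⟨z₁, hz₁⟩ := hZ
  -- the graded Neumann count in `F₁(K)`, then `dim F₁(K) ≤ |K|³ + |K|²`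
  have N1 := LevelTwoBeatsCubes.Negative.packing_X _ hr (Finset.univ.image φ) Y Z hsep' hy₁ hz₁
  have hdim : Module.finrank ℂ (Submodule.span ℂ {f : Matrix.GeneralLinearGroup (Fin 2) K → ℂ |
        ∃ c : (Fin 2 → K) → (Fin 2 → K) → ℂ, f = fun g : Matrix.GeneralLinearGroup (Fin 2) K =>
          ∑ u : Fin 2 → K, c u ((g : Matrix (Fin 2) (Fin 2) K).mulVec u)}) ≤
      Fintype.card K ^ 3 + Fintype.card K ^ 2 := by
    exact_mod_cast SubfieldCell.finrank_frameSpan_le K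
  exact N1.trans hdim

end Summit.MatrixMultiplication.MatrixMultiplication.Theorems.GradedDesignFamily.Negative

end
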